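import Summits.Ventures.PackingBounds.Energy.UniversalOptimality
import Mathlib.Analysis.SpecialFunctions.ExpDeriv

/-!
# Exponential / Gaussian potentials are absolutely monotonic; E₈, the Leech lattice and the 600-cell
minimise every Gaussian energy

Framing: lottery ticket; floor = certified bounds/negative ranges. Venture `PackingBounds` (cell
`pub-packcert`, seat `pub-packcert-energy`), energy-minimisation family — a corollary file.

For unit vectors `|x - y|² = 2 - 2⟨x,y⟩`, so the Gaussian potential `e^{-α|x-y|²}` is
`e^{-2α} e^{2α⟨x,y⟩}`: as a function of the inner product it is `a(t) = e^{-2α} e^{ct}` with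
`c = 2α ≥ 0`, and `t ↦ e^{ct}` is absolutely monotonic (`k`-th derivative `c^k e^{ct} ≥ 0`;
`absolutelyMonotoneOn_exp_const_mul`, from Mathlib's `iteratedDeriv_exp_const_mul`). Hence, by the
kernel-checked universal optimality of `UniversalOptimality.lean` (Cohn–Kumar 2007, Thm. 1.2), the
`E₈` roots, the Leech minimal vectors and the regular 600-cell minimise `Σ_{x ≠ y} e^{c⟨x,y⟩}` (and so
every Gaussian energy) among configurations of their size, for EVERY `c ≥ 0`
(`exp_energy_ge_E8`, `_Leech`, `_SixHundredCell`), with the explicit minimal values.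

## References
* H. Cohn, A. Kumar, *Universally optimal distribution of points on spheres*, J. Amer. Math. Soc.
  20 (2007) 99–148, Theorem 1.2. [`CohnKumar2006`]
-/

noncomputable section

namespace Summit.Ventures.PackingBounds.Energy

open Finset Set
open scoped ContDiff

/-- `t ↦ e^{ct}` is absolutely monotonic on `[-1,1)` (indeed everywhere) for `c ≥ 0`. [folklore] -/
theorem absolutelyMonotoneOn_exp_const_mul (c : ℝ) (hc : 0 ≤ c) :
    AbsolutelyMonotoneOn (fun t : ℝ => Real.exp (c * t)) (Ico (-1) 1) := by
  refine AbsolutelyMonotoneOn.of_contDiff ?_ fun n x _ => ?_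
  · exact Real.contDiff_exp.comp (contDiff_const.mul contDiff_id)
  · rw [iteratedDeriv_exp_const_mul]
    positivity

open scoped Classical in
/-- **`E₈` minimises every exponential / Gaussian energy** among 240-point configurations on `S⁷`:
for `c ≥ 0`, `Σ_{x ≠ y} e^{c⟨x,y⟩} ≥ 240 (e^{-c} + 56 e^{-c/2} + 126 + 56 e^{c/2})`, the value at the
E₈ roots. [cite: CohnKumar2006, Theorem 1.2] -/
theorem exp_energy_ge_E8 (c : ℝ) (hc : 0 ≤ c) (C : Finset (EuclideanSpace ℝ (Fin 8)))
    (h1 : ∀ x ∈ C, ‖x‖ = 1) (hN : C.card = 240) :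
    (240 : ℝ) * (Real.exp (c * (-1)) + 56 * Real.exp (c * (-1 / 2)) + 126 * Real.exp (c * 0)
        + 56 * Real.exp (c * (1 / 2))) ≤
      ∑ x ∈ C, ∑ y ∈ C.erase x, Real.exp (c * inner ℝ x y) :=
  UniversalE8.universallyOptimal_of_absolutelyMonotoneOn (fun t : ℝ => Real.exp (c * t))
    (absolutelyMonotoneOn_exp_const_mul c hc) C h1 hN

open scoped Classical in
/-- **The Leech lattice minimal vectors minimise every exponential / Gaussian energy** among
196560-point configurations on `S²³` (`c ≥ 0`). [cite: CohnKumar2006, Theorem 1.2] -/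
theorem exp_energy_ge_Leech (c : ℝ) (hc : 0 ≤ c) (C : Finset (EuclideanSpace ℝ (Fin 24)))
    (h1 : ∀ x ∈ C, ‖x‖ = 1) (hN : C.card = 196560) :
    (196560 : ℝ) * (Real.exp (c * (-1)) + 4600 * Real.exp (c * (-1 / 2))
        + 47104 * Real.exp (c * (-1 / 4)) + 93150 * Real.exp (c * 0)
        + 47104 * Real.exp (c * (1 / 4)) + 4600 * Real.exp (c * (1 / 2))) ≤
      ∑ x ∈ C, ∑ y ∈ C.erase x, Real.exp (c * inner ℝ x y) := by
  have h := UniversalLeech.universallyOptimal_of_absolutelyMonotoneOn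
    (fun t : ℝ => Real.exp (c * t)) (absolutelyMonotoneOn_exp_const_mul c hc) C h1 hN
  refine le_trans (le_of_eq ?_) h
  norm_num

open scoped Classical in
/-- **The regular 600-cell minimises every exponential / Gaussian energy** among 120-point
configurations on `S³` (`c ≥ 0`); inner products `-1, (-1-√5)/4, -1/2, (1-√5)/4, 0, (√5-1)/4, 1/2,
(1+√5)/4` with multiplicities `1, 12, 20, 12, 30, 12, 20, 12`. [cite: CohnKumar2006, Theorem 1.2] -/
theorem exp_energy_ge_SixHundredCell (c : ℝ) (hc : 0 ≤ c) (C : Finset (EuclideanSpace ℝ (Fin 4)))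
    (h1 : ∀ x ∈ C, ‖x‖ = 1) (hN : C.card = 120) :
    (120 : ℝ) * (Real.exp (c * (-1)) + 12 * Real.exp (c * ((-1 / 4 : ℝ) + (-1 / 4 : ℝ) * Real.sqrt 5))
        + 20 * Real.exp (c * (-1 / 2)) + 12 * Real.exp (c * ((1 / 4 : ℝ) + (-1 / 4 : ℝ) * Real.sqrt 5))
        + 30 * Real.exp (c * 0) + 12 * Real.exp (c * ((-1 / 4 : ℝ) + (1 / 4 : ℝ) * Real.sqrt 5))
        + 20 * Real.exp (c * (1 / 2)) + 12 * Real.exp (c * ((1 / 4 : ℝ) + (1 / 4 : ℝ) * Real.sqrt 5))) ≤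
      ∑ x ∈ C, ∑ y ∈ C.erase x, Real.exp (c * inner ℝ x y) :=
  UniversalSixHundredCell.universallyOptimal_of_absolutelyMonotoneOn (fun t : ℝ => Real.exp (c * t))
    (absolutelyMonotoneOn_exp_const_mul c hc) C h1 hN

end Summit.Ventures.PackingBounds.Energy

end
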